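import Literature.AlgebraicGeometry.HodgeTheory.AbelianVarietyEndomorphismStableSubvarieties
import Literature.AlgebraicGeometry.HodgeTheory.AbelianVarietyIsotypicCentralIdempotents
import HarnessLib

/-!
# The endomorphism-stable abelian subvarieties of an abelian variety are exactly the `2^r` sums of isotypic components
# (Mumford §19 Cor. 1–2; Silverberg–Zarhin 2015 Def. 2.2–2.3, Lemma 3.1; Lenstra–Oort–Zarhin 1996 via Zarhin 2008 Thm. 3.2)

Layer `Literature/AlgebraicGeometry/HodgeTheory`; theorems only (no `def`, no instance, no named fact; net debt 0).  Sequel of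
`HodgeTheory/AbelianVarietyEndomorphismStableSubvarieties` («finitely many abelian subvarieties ⟺ all of them `End X`-stable»): for
EVERY abelian variety the `End X`-stable abelian subvarieties (`φ(Z) ⊆ Z` for all `φ ∈ End X`, recorded on closed subsets) are
classified — they are the sums `Σ_{q ∈ S} Y_q` of isotypic components, `2^r` in number (`r` = number of isotypic components =
number of blocks of `End⁰ X`), as many as the central idempotents of `End⁰ X`.

§1 holds over ANY field for a system of abelian subvarieties `i_q : Y_q ↪ X` whose addition map is an isogeny (quasi-inverse `v`,
`desc i ≫ v = m • 𝟙`, `v ≫ desc i = m • 𝟙`, projectors `u_q = (v ≫ π_q) ≫ i_q`) with members `Y_q ∼ B_q^{n_q+1}`, `B_q` SIMPLE.  KEY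
STEP (`range_component_subset_of_forall_range_comp_subset`): if `Z ↪ X` is `End X`-stable and its `q`-th piece is non-zero
(`j ≫ u_q ≠ 0`) then `Y_q ⊆ Z` — with the matrix units `a_l : X → B_q`, `b_l : B_q → X` (`Σ_l a_l ≫ b_l = N • u_q`) some `j ≫ a_{l₀}`
is non-zero, hence SURJECTIVE onto the simple `B_q`, so `b_l(B_q) = (a_{l₀} ≫ b_l)(Z) ⊆ Z` for every `l` and `Y_q = Σ_l b_l(B_q) ⊆ Z`.
With `Z ⊆ Σ_{supp Z} Y_q` (`…SubvarietyIsotypicSupport`) this gives `Z = Σ_{q ∈ supp Z} Y_q`.  §2: over a PERFECT field every `X` has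
isotypic components, so the `End X`-stable abelian subvarieties of `X` are finite in number, `2^r` of them.

THE PRINT.  Mumford, *Abelian Varieties* (1970) §19 Cor. 1–2 of Thm. 1 (pp. 173–174: `X ∼ ∏ X_i^{n_i}`, `End⁰ X = ⊕ M_{n_i}(D_i)`);
Silverberg–Zarhin, *Isogenies of abelian varieties over finite fields* (2015) Def. 2.2–2.3 (p. 3: isotypic components are the
maximal isotypic abelian subvarieties) and Lemma 3.1 (p. 5); Zarhin 2008 Thm. 3.2 and §5 (pp. 7, 9: Lenstra–Oort–Zarhin, finiteness
up to `Aut(X)`); Lam, *A First Course in Noncommutative Rings* §22 Prop. (22.1) (p. 326: `2^r` central idempotents).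

Results (namespace `Literature.AlgebraicGeometry.HodgeTheory.AbelianVariety`):
* §1 (any field) **`range_component_subset_of_forall_range_comp_subset`** (KEY STEP), **`exists_range_eq_range_biproduct_desc_of_forall_range_comp_subset`**
  (an `End X`-stable abelian subvariety is a sum of components), **`setOf_range_stable_subvariety_eq_range`** (the `End X`-stable
  abelian subvarieties are exactly the `2^{#Q}` sums `Σ_{q ∈ S} Y_q`), **`natCard_setOf_range_stable_subvariety`** (`= 2^{#Q}`),
  `finite_setOf_range_stable_subvariety_of_components`;
* §2 (perfect field, every `X`) **`finite_setOf_range_stable_subvariety`**,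
  **`natCard_setOf_range_stable_subvariety_eq_ncard_central_idempotents`** (`#{End X-stable abelian subvarieties} = #{central
  idempotents of End⁰ X}`), `exists_natCard_setOf_range_stable_subvariety_eq_two_pow` (`= 2^r` for `X ∼ ⨁_{q<r} B_q^{n_q+1}`).

## References
* [MumfordAV1970] D. Mumford, *Abelian Varieties* (1970), §19 Thm. 1, Cor. 1–2, Thm. 3 (pp. 173–176).
* [SilverbergZarhin2015] A. Silverberg, Yu. G. Zarhin, *Isogenies of abelian varieties over finite fields* (2015)
  (arXiv:1409.0592), Def. 2.2–2.3 (p. 3), Lemma 3.1 (p. 5).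
* [Zarhin2008HomomorphismsFiniteFields] Yu. G. Zarhin, *Homomorphisms of abelian varieties over finite fields* (2008)
  (arXiv:0711.1615), Thm. 3.2 and §5 (pp. 7, 9).
* [Lam2001FirstCourse] T. Y. Lam, *A First Course in Noncommutative Rings*, 2nd ed. (2001), §22 Prop. (22.1) p. 326.
-/

noncomputable section

universe u

open CategoryTheory CategoryTheory.Limits

namespace Literature.AlgebraicGeometry.HodgeTheory

namespace AbelianVariety

open _root_.AlgebraicGeometry
open Literature.AlgebraicGeometry.Motives Literature.AlgebraicGeometry.Motives.AbelianVariety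

variable {K : Type u} [Field K]

/-! ## §1 Stable abelian subvarieties are sums of components (any field) -/

section AnyField

variable {X Z : Motives.AbelianVariety K} {Q : Type} [Fintype Q] {Y B : Q → Motives.AbelianVariety K} {n : Q → ℕ}
  (i : ∀ q, Y q ⟶ X) {v : X ⟶ ⨁ Y} {m : ℕ} (j : Z ⟶ X)

/-- **KEY STEP: an `End X`-stable abelian subvariety with non-zero `q`-th piece contains the whole component `Y_q`** (any field;
`Y_q ∼ B^ι` with `B` SIMPLE): with matrix units `a_l : X → B`, `b_l : B → X`, `Σ_l a_l ≫ b_l = N • u_q`, some `Z → X → B` (`= j ≫ a_{l₀}`)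
is non-zero, hence surjective onto the simple `B`; then `b_l(B) = (a_{l₀} ≫ b_l)(Z) ⊆ Z` for all `l`, and `Y_q = Σ_l b_l(B) ⊆ Z`.
[cite: SilverbergZarhin2015, Def. 2.2–2.3 (p. 3) and Lemma 3.1 (p. 5)] [cite: MumfordAV1970, §19 Cor. 2 of Thm. 1 (p. 174) and Remark p. 169] -/
theorem range_component_subset_of_forall_range_comp_subset {q : Q} {C : Motives.AbelianVariety K} {ι : Type} [Fintype ι]
    (hC : C.IsSimple) (hY : IsIsogenous (Y q) (⨁ fun _ : ι ↦ C)) [IsClosedImmersion (Hom.toSchemeHom j)]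
    (hstab : ∀ φ : X ⟶ X, Set.range (Hom.toSchemeHom (j ≫ φ)) ⊆ Set.range (Hom.toSchemeHom j))
    (hq : j ≫ (v ≫ biproduct.π Y q) ≫ i q ≠ 0) :
    Set.range (Hom.toSchemeHom (i q)) ⊆ Set.range (Hom.toSchemeHom j) := by
  classical
  obtain ⟨e, he⟩ := hY
  obtain ⟨w, N, hN, hew, -⟩ := IsIsogeny.exists_nsmul_inverse_holds he
  set a : ι → (X ⟶ C) := fun l ↦ (v ≫ biproduct.π Y q) ≫ e ≫ biproduct.π (fun _ : ι ↦ C) l with ha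
  set b : ι → (C ⟶ X) := fun l ↦ biproduct.ι (fun _ : ι ↦ C) l ≫ w ≫ i q with hb
  -- `Σ_l a_l ≫ b_l = N • u_q`
  have hsum : ∑ l, a l ≫ b l = N • ((v ≫ biproduct.π Y q) ≫ i q) := by
    have h1 : ∀ l, a l ≫ b l =
        (v ≫ biproduct.π Y q) ≫ e ≫ (biproduct.π (fun _ : ι ↦ C) l ≫ biproduct.ι (fun _ : ι ↦ C) l) ≫ w ≫ i q := fun l ↦ by
      simp only [ha, hb, Category.assoc]
    rw [Finset.sum_congr rfl fun l _ ↦ h1 l, ← Preadditive.comp_sum, ← Preadditive.comp_sum, ← Preadditive.sum_comp,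
      biproduct.total, Category.id_comp, ← Category.assoc e w, hew, Preadditive.nsmul_comp, Category.id_comp,
      Preadditive.comp_nsmul]
  -- some `j ≫ a_{l₀}` is non-zero …
  have hl : ∃ l, j ≫ a l ≠ 0 := by
    by_contra hall
    simp only [not_exists, not_not] at hall
    refine hq (hom_eq_zero_of_nsmul_eq_zero hN.ne' ?_)
    rw [← Preadditive.comp_nsmul, ← hsum, Preadditive.comp_sum]
    exact Finset.sum_eq_zero fun l _ ↦ by rw [← Category.assoc, hall l, zero_comp]
  obtain ⟨l₀, hl₀⟩ := hl
  -- … hence surjective onto the simple `C`, so every `b_l(C) ⊆ Z`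
  haveI := surjective_of_isSimple (j ≫ a l₀) hC hl₀
  have hbsub : ∀ l, Set.range (Hom.toSchemeHom (b l)) ⊆ Set.range (Hom.toSchemeHom j) := fun l ↦ by
    rw [← range_toSchemeHom_comp_eq_of_surjective (j ≫ a l₀) (b l), Category.assoc]
    exact hstab (a l₀ ≫ b l)
  choose g hg using fun l ↦ (existsUnique_hom_comp_eq_of_range_subset (b l) j (hbsub l)).exists
  -- `Y_q = (w ≫ i_q)(C^ι) = Σ_l b_l(C) ⊆ Z`
  have hwi : w ≫ i q = biproduct.desc b := biproduct.hom_ext' _ _ fun l ↦ by rw [biproduct.ι_desc, hb]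
  have hdb : biproduct.desc b = biproduct.desc g ≫ j :=
    biproduct.hom_ext' _ _ fun l ↦ by rw [biproduct.ι_desc, biproduct.ι_desc_assoc, hg]
  haveI : Surjective (Hom.toSchemeHom w) := surjective_of_comp_eq_nsmul_id hN.ne' hew
  rw [← range_toSchemeHom_comp_eq_of_surjective w (i q), hwi, hdb]
  exact range_toSchemeHom_comp_subset _ _

/-- **AN `End X`-STABLE ABELIAN SUBVARIETY IS A SUM OF COMPONENTS** (any field): for a system `i_q : Y_q ↪ X` with addition map an
isogeny (quasi-inverse `v`, `m ≠ 0`) and members `Y_q ∼ B_q^{n_q+1}` with `B_q` simple, an abelian subvariety `j : Z ↪ X` with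
`φ(Z) ⊆ Z` for every `φ ∈ End X` has `range j = range (⨁_{q ∈ S} Y_q → X)` for `S = supp Z = {q : j ≫ u_q ≠ 0}`.
[cite: SilverbergZarhin2015, Def. 2.2–2.3 (p. 3) and Lemma 3.1 (p. 5)] [cite: MumfordAV1970, §19 Cor. 1–2 of Thm. 1 (pp. 173–174)] -/
theorem exists_range_eq_range_biproduct_desc_of_forall_range_comp_subset (hdv : biproduct.desc i ≫ v = m • 𝟙 (⨁ Y))
    (hvd : v ≫ biproduct.desc i = m • 𝟙 X) (hm : m ≠ 0) (hB : ∀ q, (B q).IsSimple)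
    (hY : ∀ q, IsIsogenous (Y q) (⨁ fun _ : Fin (n q + 1) ↦ B q)) [IsClosedImmersion (Hom.toSchemeHom j)]
    (hstab : ∀ φ : X ⟶ X, Set.range (Hom.toSchemeHom (j ≫ φ)) ⊆ Set.range (Hom.toSchemeHom j)) :
    ∃ S : Finset Q, Set.range (Hom.toSchemeHom j) = Set.range (Hom.toSchemeHom (biproduct.desc fun s : S ↦ i s)) := by
  classical
  obtain ⟨S, hS⟩ : ∃ S : Finset Q, ∀ q, q ∈ S ↔ j ≫ (v ≫ biproduct.π Y q) ≫ i q ≠ 0 :=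
    ⟨Finset.univ.filter fun q ↦ j ≫ (v ≫ biproduct.π Y q) ≫ i q ≠ 0, fun q ↦ by
      simp only [Finset.mem_filter, Finset.mem_univ, true_and]⟩
  refine ⟨S, le_antisymm ?_ ?_⟩
  · exact (range_subset_range_desc_components_iff i j hdv hvd hm S).2 fun q hq ↦ not_not.1 ((hS q).not.1 hq)
  · have hsub : ∀ s : S, Set.range (Hom.toSchemeHom (i s)) ⊆ Set.range (Hom.toSchemeHom j) := fun s ↦
      range_component_subset_of_forall_range_comp_subset i j (hB s) (hY s) hstab ((hS s).1 s.2)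
    choose g hg using fun s : S ↦ (existsUnique_hom_comp_eq_of_range_subset (i s) j (hsub s)).exists
    have hfac : (biproduct.desc fun s : S ↦ i s) = biproduct.desc g ≫ j :=
      biproduct.hom_ext' _ _ fun s ↦ by rw [biproduct.ι_desc, biproduct.ι_desc_assoc, hg]
    rw [hfac]
    exact range_toSchemeHom_comp_subset _ _

/-- **THE `End X`-STABLE ABELIAN SUBVARIETIES ARE EXACTLY THE SUMS `Σ_{q ∈ S} Y_q` OF COMPONENTS** (any field; `Hom`-orthogonal system
`i_q : Y_q ↪ X`, addition map an isogeny, `Y_q ∼ B_q^{n_q+1}` with `B_q` simple; closed subsets).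
[cite: SilverbergZarhin2015, Def. 2.2–2.3 (p. 3) and Lemma 3.1 (p. 5)] [cite: MumfordAV1970, §19 Cor. 1–2 of Thm. 1 (pp. 173–174)]
[cite: Zarhin2008HomomorphismsFiniteFields, Thm. 3.2 and §5 (pp. 7, 9)] -/
theorem setOf_range_stable_subvariety_eq_range (hdesc : IsIsogeny (biproduct.desc i)) (horth : ∀ q q', q ≠ q' → ∀ f : Y q ⟶ Y q', f = 0) (hB : ∀ q, (B q).IsSimple)
    (hY : ∀ q, IsIsogenous (Y q) (⨁ fun _ : Fin (n q + 1) ↦ B q)) :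
    {R : Set X.X.left | ∃ (Z : Motives.AbelianVariety K) (j : Z ⟶ X), IsClosedImmersion (Hom.toSchemeHom j) ∧
        R = Set.range (Hom.toSchemeHom j) ∧ ∀ φ : X ⟶ X, Set.range (Hom.toSchemeHom (j ≫ φ)) ⊆ Set.range (Hom.toSchemeHom j)} =
      Set.range fun S : Finset Q ↦ Set.range (Hom.toSchemeHom (biproduct.desc fun s : S ↦ i s)) := by
  obtain ⟨v, m, hm, hdv, hvd⟩ := IsIsogeny.exists_nsmul_inverse_holds hdesc
  ext R
  constructor
  · rintro ⟨Z, j, hj, rfl, hstab⟩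
    haveI := hj
    obtain ⟨S, hS⟩ := exists_range_eq_range_biproduct_desc_of_forall_range_comp_subset i j hdv hvd hm.ne' hB hY hstab
    exact ⟨S, hS.symm⟩
  · rintro ⟨S, rfl⟩
    exact ⟨_, imageι (biproduct.desc fun s : S ↦ i s), inferInstance, (range_toSchemeHom_imageι _).symm, fun φ ↦
      range_comp_subset_of_range_eq_range_biproduct_desc i hdesc horth (imageι _) (range_toSchemeHom_imageι _) φ⟩

/-- **EXACTLY `2^{#Q}` `End X`-STABLE ABELIAN SUBVARIETIES** (any field; hypotheses as above with `0 < dim B_q`).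
[cite: MumfordAV1970, §19 Cor. 1–2 of Thm. 1 (pp. 173–174)] [cite: Zarhin2008HomomorphismsFiniteFields, Thm. 3.2 and §5 (pp. 7, 9)] -/
theorem natCard_setOf_range_stable_subvariety (hi : ∀ q, IsClosedImmersion (Hom.toSchemeHom (i q)))
    (hdesc : IsIsogeny (biproduct.desc i)) (horth : ∀ q q', q ≠ q' → ∀ f : Y q ⟶ Y q', f = 0) (hB : ∀ q, (B q).IsSimple)
    (hB0 : ∀ q, 0 < (B q).dim) (hY : ∀ q, IsIsogenous (Y q) (⨁ fun _ : Fin (n q + 1) ↦ B q)) :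
    Nat.card {R : Set X.X.left | ∃ (Z : Motives.AbelianVariety K) (j : Z ⟶ X), IsClosedImmersion (Hom.toSchemeHom j) ∧
        R = Set.range (Hom.toSchemeHom j) ∧ ∀ φ : X ⟶ X, Set.range (Hom.toSchemeHom (j ≫ φ)) ⊆ Set.range (Hom.toSchemeHom j)} =
      2 ^ Fintype.card Q := by
  classical
  obtain ⟨v, m, hm, hdv, hvd⟩ := IsIsogeny.exists_nsmul_inverse_holds hdesc
  have hY0 : ∀ q, 0 < (Y q).dim := fun q ↦ by
    rw [dim_eq_mul_of_isIsogenous_biproduct_const (hY q)]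
    exact Nat.mul_pos (Nat.succ_pos _) (hB0 q)
  rw [setOf_range_stable_subvariety_eq_range i hdesc horth hB hY,
    Nat.card_range_of_injective (injective_range_biproduct_desc_components i hi hdv hvd hm.ne' hY0),
    Nat.card_eq_fintype_card, Fintype.card_finset]

/-- The set of `End X`-stable abelian subvarieties is finite (any field; hypotheses as above). [cite: Zarhin2008HomomorphismsFiniteFields, Thm. 3.2 and §5 (pp. 7, 9)] -/
theorem finite_setOf_range_stable_subvariety_of_components (hdesc : IsIsogeny (biproduct.desc i)) (horth : ∀ q q', q ≠ q' → ∀ f : Y q ⟶ Y q', f = 0) (hB : ∀ q, (B q).IsSimple)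
    (hY : ∀ q, IsIsogenous (Y q) (⨁ fun _ : Fin (n q + 1) ↦ B q)) :
    {R : Set X.X.left | ∃ (Z : Motives.AbelianVariety K) (j : Z ⟶ X), IsClosedImmersion (Hom.toSchemeHom j) ∧
        R = Set.range (Hom.toSchemeHom j) ∧ ∀ φ : X ⟶ X, Set.range (Hom.toSchemeHom (j ≫ φ)) ⊆ Set.range (Hom.toSchemeHom j)}.Finite := by
  rw [setOf_range_stable_subvariety_eq_range i hdesc horth hB hY]
  exact Set.finite_range _

end AnyField

/-! ## §2 Every abelian variety over a perfect field: `2^r` stable abelian subvarieties -/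

section Perfect

variable [PerfectField K] (X : Motives.AbelianVariety K)

/-- **EVERY ABELIAN VARIETY OVER A PERFECT FIELD HAS ONLY FINITELY MANY `End X`-STABLE ABELIAN SUBVARIETIES** (the sums of isotypic
components). [cite: Zarhin2008HomomorphismsFiniteFields, Thm. 3.2 and §5 (pp. 7, 9)] [cite: SilverbergZarhin2015, Def. 2.2–2.3 (p. 3)] -/
theorem finite_setOf_range_stable_subvariety :
    {R : Set X.X.left | ∃ (Z : Motives.AbelianVariety K) (j : Z ⟶ X), IsClosedImmersion (Hom.toSchemeHom j) ∧
        R = Set.range (Hom.toSchemeHom j) ∧ ∀ φ : X ⟶ X, Set.range (Hom.toSchemeHom (j ≫ φ)) ⊆ Set.range (Hom.toSchemeHom j)}.Finite := by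
  obtain ⟨r, B, n, Y, i, hB, -, -, -, hY, -, hdesc, horth⟩ := exists_isotypicComponents_orthogonal X
  exact finite_setOf_range_stable_subvariety_of_components i hdesc horth hB hY

/-- **`#{End X-stable abelian subvarieties of X} = #{central idempotents of End⁰ X}`** (`= 2^r`, `r` the number of isotypic components;
every abelian variety over a perfect field). [cite: MumfordAV1970, §19 Cor. 1–2 of Thm. 1 (pp. 173–174)] [cite: Lam2001FirstCourse, §22 Prop. (22.1) p. 326]
[cite: Zarhin2008HomomorphismsFiniteFields, Thm. 3.2 and §5 (pp. 7, 9)] -/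
theorem natCard_setOf_range_stable_subvariety_eq_ncard_central_idempotents :
    Nat.card {R : Set X.X.left | ∃ (Z : Motives.AbelianVariety K) (j : Z ⟶ X), IsClosedImmersion (Hom.toSchemeHom j) ∧
        R = Set.range (Hom.toSchemeHom j) ∧ ∀ φ : X ⟶ X, Set.range (Hom.toSchemeHom (j ≫ φ)) ⊆ Set.range (Hom.toSchemeHom j)} =
      {z : X.endAlgebra | IsIdempotentElem z ∧ ∀ a, z * a = a * z}.ncard := by
  obtain ⟨r, B, n, Y, i, hB, hB0, hni, hi, hY, -, hdesc, horth⟩ := exists_isotypicComponents_orthogonal X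
  rw [natCard_setOf_range_stable_subvariety i hi hdesc horth hB hB0 hY,
    ncard_setOf_central_idempotent_endAlgebra_eq_two_pow hB hB0 hni hY i hi hdesc]

/-- **With `r` isotypic components (`X ∼ ⨁_{q<r} B_q^{n_q+1}`, `B_q` simple pairwise non-isogenous) there are exactly `2^r`
`End X`-stable abelian subvarieties** (every abelian variety over a perfect field). [cite: MumfordAV1970, §19 Cor. 1–2 of Thm. 1 (pp. 173–174)]
[cite: Zarhin2008HomomorphismsFiniteFields, Thm. 3.2 and §5 (pp. 7, 9)] -/
theorem exists_natCard_setOf_range_stable_subvariety_eq_two_pow :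
    ∃ (r : ℕ) (B : Fin r → Motives.AbelianVariety K) (n : Fin r → ℕ), (∀ q, (B q).IsSimple) ∧ (∀ q, 0 < (B q).dim) ∧
      (∀ q q', q ≠ q' → ¬ IsIsogenous (B q) (B q')) ∧ IsIsogenous X (⨁ fun q ↦ ⨁ fun _ : Fin (n q + 1) ↦ B q) ∧
      Nat.card {R : Set X.X.left | ∃ (Z : Motives.AbelianVariety K) (j : Z ⟶ X), IsClosedImmersion (Hom.toSchemeHom j) ∧
        R = Set.range (Hom.toSchemeHom j) ∧ ∀ φ : X ⟶ X, Set.range (Hom.toSchemeHom (j ≫ φ)) ⊆ Set.range (Hom.toSchemeHom j)} =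
        2 ^ r := by
  classical
  obtain ⟨r, B, n, Y, i, hB, hB0, hni, hi, hY, -, hdesc, horth⟩ := exists_isotypicComponents_orthogonal X
  refine ⟨r, B, n, hB, hB0, hni, ?_, ?_⟩
  · exact (IsIsogenous.symm' ⟨biproduct.desc i, hdesc⟩).trans (IsIsogenous.biproduct hY)
  · rw [natCard_setOf_range_stable_subvariety i hi hdesc horth hB hB0 hY, Fintype.card_fin]

end Perfect

end AbelianVariety

end Literature.AlgebraicGeometry.HodgeTheory

end
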